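import Mathlib.Analysis.InnerProductSpace.Spectrum
import Mathlib.Analysis.InnerProductSpace.PiL2
import HarnessLib

/-!
# Route `UnitScaleTilt`, crux K1 «MinimiserStabilityRegPr» (stmt-QuantumFields-19200), route-R E′ growth side — the SPECTRAL THRESHOLD SPLIT
# (slow ∕ fast sectors of a positive symmetric operator on a finite-dimensional real inner-product space), the letter every «slow-sector»
# bookkeeping of the curved ζ-row (S3 of ✓`Prop7PV3EOfCorrectorRows.stub_PV3E_of_correctorRows`) needs

Cell `ym3-torus` ∕ fleet seat `ym-ust-19200-p1` (gen 15, route-R E′ lead ∕ namer).  THEOREMS ONLY (0 `def`, 0 `sorry`); `--supports stmt-QuantumFields-19200`,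
count-neutral.  YM₃ on T³ is a ladder rung (R3), not the Clay problem; nothing here claims a stub, the crux, d = 4 or the mass gap.

WHY (p1 g15 LOCATE-S3-NEAR-REDUCIBLE §0, kit «S3-CURVED» 2026-08-28).  Every curved transcription of the flat ζ-row engine (✓`Prop7CentreHarmonicDivEngine`) meets the
commutator `[F_W, φ₀]` of the curvature with the UNDIFFERENTIATED covariant Hodge potential `φ₀ = Δ_W⁻¹D*_W D` of the representative; pointwise bounds
`‖[F,φ₀]‖ ≤ 2a‖φ₀‖` are affordable only for the FAST spectral sector of `Δ_W` (`‖φ_fast‖² ≤ λ*⁻¹⟨φ, Δ_Wφ⟩`), while the SLOW sector (`λ < λ*`; the near-reducible ∕ aligned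
sections) must be handled spectrally (`‖Δ_Wφ_slow‖² ≤ λ*⟨φ_slow, Δ_Wφ_slow⟩ ≤ λ*²‖φ_slow‖²`, `Δ_W` nearly kills it) and booked against the curl energy `K` (the K-form row
`hKg-K`, numerically `C_g ≈ 0.8–1.2` at ℓ = 3).  This file is the abstract finite-dimensional linear algebra of that split, once, for every consumer (route-R S3, the
LEMMA-H-curved slack, the EX lane's HESS rows): for a symmetric `A ≥ 0` on a finite-dimensional real inner-product space and a threshold `t`, the spectral projection `P`
onto the eigenvalues `< t` is an `A`-commuting orthogonal projection with `⟨A Py, Py⟩ ≤ t‖Py‖²`, `‖A Py‖² ≤ t⟨A Py, Py⟩`, `t‖y − Py‖² ≤ ⟨A(y − Py), y − Py⟩`, and the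
mass ∕ energy split exactly.

WHAT IS PROVED (ns `…Theorems.Prop7SpectralSplit`; `V` a finite-dimensional real inner-product space, `A : V →ₗ[ℝ] V` symmetric).
§1 coordinates in the eigenbasis: `inner_eq_sum_repr`, `norm_sq_eq_sum_repr`, `inner_apply_eq_sum_eigenvalues`, `norm_apply_sq_eq_sum_eigenvalues`, `eigenvalues_nonneg_of_inner_nonneg`.
§2 ★★ `exists_spectral_split` (the eight rows above for `P = Σ_{μ_i < t} ⟨b_i, ·⟩ b_i`); ★ `exists_slow_fast_decomposition` (per-vector reading: `y = s + f` with the rows).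
HONEST SCOPE.  Folklore linear algebra over Mathlib's `LinearMap.IsSymmetric.eigenvectorBasis`; no lattice object; nothing of print asserted.

References: T. Bałaban, CMP 99 (1985) 389–434 [Balaban1985BackgroundPropagators] ((3.118)–(3.122) p.417, Thm 3.11 p.416 — the low∕high-mode separation this
serves); CMP 102 (1985) 277–309 [Balaban1985Variational] ((79) p.290, (141)–(143) p.299).
-/

set_option autoImplicit false

noncomputable section

open scoped BigOperators InnerProductSpace

namespace Summit.QuantumFields.YangMills.Theorems.Prop7SpectralSplit

variable {V : Type*} [NormedAddCommGroup V] [InnerProductSpace ℝ V] [FiniteDimensional ℝ V]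

/-! ## §1 Coordinates in the orthonormal eigenbasis of a symmetric operator -/

section Coordinates

variable {A : V →ₗ[ℝ] V} {n : ℕ}

/-- `⟨u, v⟩ = Σ_j (b.repr u)_j (b.repr v)_j` in the orthonormal eigenbasis `b` (Parseval). [folklore] -/
theorem inner_eq_sum_repr (hA : A.IsSymmetric) (hn : Module.finrank ℝ V = n) (u v : V) :
    ⟪u, v⟫_ℝ = ∑ j, (hA.eigenvectorBasis hn).repr u j * (hA.eigenvectorBasis hn).repr v j := by
  set b := hA.eigenvectorBasis hn with hb
  rw [← b.repr.inner_map_map u v, PiLp.inner_apply]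
  refine Finset.sum_congr rfl fun j _ => ?_
  simp only [RCLike.inner_apply, conj_trivial]
  ring

/-- `‖z‖² = Σ_j (b.repr z)_j²` (Parseval). [folklore] -/
theorem norm_sq_eq_sum_repr (hA : A.IsSymmetric) (hn : Module.finrank ℝ V = n) (z : V) : ‖z‖ ^ 2 = ∑ j, ((hA.eigenvectorBasis hn).repr z j) ^ 2 := by
  rw [← real_inner_self_eq_norm_sq, inner_eq_sum_repr hA hn z z]
  exact Finset.sum_congr rfl fun j _ => by ring

/-- `⟨A z, z⟩ = Σ_j μ_j (b.repr z)_j²` (`μ` the eigenvalues). [folklore] -/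
theorem inner_apply_eq_sum_eigenvalues (hA : A.IsSymmetric) (hn : Module.finrank ℝ V = n) (z : V) :
    ⟪A z, z⟫_ℝ = ∑ j, hA.eigenvalues hn j * ((hA.eigenvectorBasis hn).repr z j) ^ 2 := by
  rw [inner_eq_sum_repr hA hn (A z) z]
  refine Finset.sum_congr rfl fun j _ => ?_
  rw [hA.eigenvectorBasis_apply_self_apply hn z j]
  simp only [RCLike.ofReal_real_eq_id, id_eq]
  ring

/-- `‖A z‖² = Σ_j μ_j² (b.repr z)_j²`. [folklore] -/
theorem norm_apply_sq_eq_sum_eigenvalues (hA : A.IsSymmetric) (hn : Module.finrank ℝ V = n) (z : V) :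
    ‖A z‖ ^ 2 = ∑ j, (hA.eigenvalues hn j) ^ 2 * ((hA.eigenvectorBasis hn).repr z j) ^ 2 := by
  rw [norm_sq_eq_sum_repr hA hn (A z)]
  refine Finset.sum_congr rfl fun j _ => ?_
  rw [hA.eigenvectorBasis_apply_self_apply hn z j]
  simp only [RCLike.ofReal_real_eq_id, id_eq]
  ring

/-- A symmetric operator with `⟨A y, y⟩ ≥ 0` has nonnegative eigenvalues. [folklore] -/
theorem eigenvalues_nonneg_of_inner_nonneg (hA : A.IsSymmetric) (hn : Module.finrank ℝ V = n)
    (hpos : ∀ y : V, 0 ≤ ⟪A y, y⟫_ℝ) (j : Fin n) :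
    0 ≤ hA.eigenvalues hn j := by
  set b := hA.eigenvectorBasis hn with hb
  have h := hpos (b j)
  rw [hb, hA.apply_eigenvectorBasis hn j, real_inner_smul_left, real_inner_self_eq_norm_sq, ← hb,
    b.orthonormal.1 j] at h
  simpa using h

end Coordinates

/-! ## §2 The spectral threshold split -/

section Split

variable {A : V →ₗ[ℝ] V}

set_option maxHeartbeats 400000 in
/-- ★★ **SPECTRAL THRESHOLD SPLIT.**  For a symmetric `A` with `⟨A y, y⟩ ≥ 0` on a finite-dimensional real inner-product space and any threshold `t`, there is a linear
`P` (the orthogonal projection onto the span of the eigenvectors with eigenvalue `< t` — the SLOW sector) with: `P² = P`, `P` symmetric, `AP = PA`;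
the exact mass split `‖y‖² = ‖Py‖² + ‖y − Py‖²` and energy split `⟨Ay, y⟩ = ⟨A Py, Py⟩ + ⟨A(y − Py), y − Py⟩`; on the slow sector `⟨A Py, Py⟩ ≤ t‖Py‖²` and
`‖A Py‖² ≤ t·⟨A Py, Py⟩` (`A` nearly kills it); on the fast sector the Poincaré inequality `t‖y − Py‖² ≤ ⟨A(y − Py), y − Py⟩`.
[cite: Balaban1985BackgroundPropagators, (3.118)-(3.122) p.417, Thm 3.11 p.416] -/
theorem exists_spectral_split (hA : A.IsSymmetric) (hpos : ∀ y : V, 0 ≤ ⟪A y, y⟫_ℝ) (t : ℝ) :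
    ∃ P : V →ₗ[ℝ] V,
      (∀ y, P (P y) = P y) ∧ (∀ x y, ⟪P x, y⟫_ℝ = ⟪x, P y⟫_ℝ) ∧ (∀ y, A (P y) = P (A y)) ∧
      (∀ y, ‖y‖ ^ 2 = ‖P y‖ ^ 2 + ‖y - P y‖ ^ 2) ∧
      (∀ y, ⟪A y, y⟫_ℝ = ⟪A (P y), P y⟫_ℝ + ⟪A (y - P y), y - P y⟫_ℝ) ∧
      (∀ y, ⟪A (P y), P y⟫_ℝ ≤ t * ‖P y‖ ^ 2) ∧
      (∀ y, ‖A (P y)‖ ^ 2 ≤ t * ⟪A (P y), P y⟫_ℝ) ∧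
      (∀ y, t * ‖y - P y‖ ^ 2 ≤ ⟪A (y - P y), y - P y⟫_ℝ) := by
  classical
  set n : ℕ := Module.finrank ℝ V with hn'
  have hn : Module.finrank ℝ V = n := rfl
  set b := hA.eigenvectorBasis hn with hb
  set μ : Fin n → ℝ := hA.eigenvalues hn with hμ
  have hμ0 : ∀ j, 0 ≤ μ j := fun j => eigenvalues_nonneg_of_inner_nonneg hA hn hpos j
  -- the slow projection `P y = Σ_{μ_i < t} ⟨b_i, y⟩ b_i`
  set S : Finset (Fin n) := Finset.univ.filter fun i => μ i < t with hS
  set P : V →ₗ[ℝ] V := ∑ i ∈ S, (innerₛₗ ℝ (b i)).smulRight (b i) with hPdef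
  have hPy : ∀ y, P y = ∑ i ∈ S, (b.repr y i) • b i := fun y => by
    rw [hPdef, LinearMap.sum_apply]
    refine Finset.sum_congr rfl fun i _ => ?_
    rw [LinearMap.smulRight_apply, innerₛₗ_apply_apply, b.repr_apply_apply]
  -- coordinates of `P y` and `y − P y`
  have hP : ∀ y j, b.repr (P y) j = if μ j < t then b.repr y j else 0 := fun y j => by
    rw [b.repr_apply_apply, hPy y, inner_sum]
    have : ∀ i ∈ S, ⟪b j, b.repr y i • b i⟫_ℝ = if j = i then b.repr y i else 0 := fun i _ => by
      rw [real_inner_smul_right, b.inner_eq_ite j i]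
      split_ifs <;> simp
    rw [Finset.sum_congr rfl this, Finset.sum_ite_eq]
    simp only [hS, Finset.mem_filter, Finset.mem_univ, true_and]
  have hPc : ∀ y j, b.repr (y - P y) j = if μ j < t then 0 else b.repr y j := fun y j => by
    rw [map_sub, PiLp.sub_apply, hP]
    split_ifs <;> ring
  refine ⟨P, fun y => ?_, fun x y => ?_, fun y => ?_, fun y => ?_, fun y => ?_, fun y => ?_, fun y => ?_, fun y => ?_⟩
  · -- P² = P
    apply b.repr.injective
    ext j
    rw [hP, hP]
    split_ifs <;> rfl
  · -- symmetry
    rw [inner_eq_sum_repr hA hn (P x) y, inner_eq_sum_repr hA hn x (P y)]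
    refine Finset.sum_congr rfl fun j _ => ?_
    rw [hP, hP]
    split_ifs <;> ring
  · -- A P = P A
    apply b.repr.injective
    ext j
    rw [hA.eigenvectorBasis_apply_self_apply hn (P y) j, hP, hP, hA.eigenvectorBasis_apply_self_apply hn y j]
    simp only [RCLike.ofReal_real_eq_id, id_eq]
    split_ifs <;> ring
  · -- mass split
    rw [norm_sq_eq_sum_repr hA hn y, norm_sq_eq_sum_repr hA hn (P y), norm_sq_eq_sum_repr hA hn (y - P y), ← Finset.sum_add_distrib]
    refine Finset.sum_congr rfl fun j _ => ?_
    rw [hP, hPc]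
    split_ifs <;> ring
  · -- energy split
    rw [inner_apply_eq_sum_eigenvalues hA hn y, inner_apply_eq_sum_eigenvalues hA hn (P y),
      inner_apply_eq_sum_eigenvalues hA hn (y - P y), ← Finset.sum_add_distrib]
    refine Finset.sum_congr rfl fun j _ => ?_
    rw [hP, hPc]
    split_ifs <;> ring
  · -- slow sector: ⟨A Py, Py⟩ ≤ t ‖Py‖²
    rw [inner_apply_eq_sum_eigenvalues hA hn (P y), norm_sq_eq_sum_repr hA hn (P y), Finset.mul_sum]
    refine Finset.sum_le_sum fun j _ => ?_
    rw [hP]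
    split_ifs with h
    · exact mul_le_mul_of_nonneg_right h.le (sq_nonneg _)
    · simp
  · -- slow sector: ‖A Py‖² ≤ t ⟨A Py, Py⟩
    rw [norm_apply_sq_eq_sum_eigenvalues hA hn (P y), inner_apply_eq_sum_eigenvalues hA hn (P y), Finset.mul_sum]
    refine Finset.sum_le_sum fun j _ => ?_
    rw [hP]
    split_ifs with h
    · have h1 : μ j ^ 2 ≤ t * μ j := by nlinarith [hμ0 j, h.le]
      calc μ j ^ 2 * (b.repr y j) ^ 2 ≤ (t * μ j) * (b.repr y j) ^ 2 := mul_le_mul_of_nonneg_right h1 (sq_nonneg _)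
        _ = t * (μ j * (b.repr y j) ^ 2) := by ring
    · simp
  · -- fast sector: t ‖y − Py‖² ≤ ⟨A (y − Py), y − Py⟩
    rw [inner_apply_eq_sum_eigenvalues hA hn (y - P y), norm_sq_eq_sum_repr hA hn (y - P y), Finset.mul_sum]
    refine Finset.sum_le_sum fun j _ => ?_
    rw [hPc]
    split_ifs with h
    · simp
    · exact mul_le_mul_of_nonneg_right (not_lt.mp h) (sq_nonneg _)

/-- ★ **PER-VECTOR READING: `y = s + f`** with `s` slow and `f` fast — `⟨s, f⟩ = 0`, `⟨A s, f⟩ = 0`, `‖y‖² = ‖s‖² + ‖f‖²`, `⟨Ay,y⟩ = ⟨As,s⟩ + ⟨Af,f⟩`,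
`⟨A s, s⟩ ≤ t‖s‖²`, `‖A s‖² ≤ t⟨A s, s⟩`, `t‖f‖² ≤ ⟨A f, f⟩`, and `A s`, `A f` are again the slow ∕ fast parts of `A y` (so `‖A s‖ ≤ ‖A y‖`, `‖A f‖ ≤ ‖A y‖`).
[cite: Balaban1985BackgroundPropagators, (3.118)-(3.122) p.417, Thm 3.11 p.416] -/
theorem exists_slow_fast_decomposition (hA : A.IsSymmetric) (hpos : ∀ y : V, 0 ≤ ⟪A y, y⟫_ℝ) (t : ℝ) (y : V) :
    ∃ s f : V, y = s + f ∧ ⟪s, f⟫_ℝ = 0 ∧ ⟪A s, f⟫_ℝ = 0 ∧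
      ‖y‖ ^ 2 = ‖s‖ ^ 2 + ‖f‖ ^ 2 ∧ ⟪A y, y⟫_ℝ = ⟪A s, s⟫_ℝ + ⟪A f, f⟫_ℝ ∧
      ⟪A s, s⟫_ℝ ≤ t * ‖s‖ ^ 2 ∧ ‖A s‖ ^ 2 ≤ t * ⟪A s, s⟫_ℝ ∧ t * ‖f‖ ^ 2 ≤ ⟪A f, f⟫_ℝ ∧
      ‖A s‖ ^ 2 + ‖A f‖ ^ 2 = ‖A y‖ ^ 2 := by
  obtain ⟨P, hPP, hsym, hcomm, hmass, hen, hslow, hslow2, hfast⟩ := exists_spectral_split hA hpos t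
  refine ⟨P y, y - P y, (add_sub_cancel (P y) y).symm, ?_, ?_, hmass y, hen y, hslow y, hslow2 y, hfast y, ?_⟩
  · -- ⟨Py, y − Py⟩ = ⟨y, P(y − Py)⟩ = ⟨y, Py − P²y⟩ = 0
    rw [hsym, map_sub, hPP, sub_self, inner_zero_right]
  · rw [hcomm, hsym, map_sub, hPP, sub_self, inner_zero_right]
  · -- ‖A Py‖² + ‖A(y − Py)‖² = ‖A y‖²: A Py = P(Ay), A(y − Py) = Ay − P(Ay), then the mass split for `A y`
    have h1 : A (P y) = P (A y) := hcomm y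
    have h2 : A (y - P y) = A y - P (A y) := by rw [map_sub, h1]
    rw [h1, h2]
    exact (hmass (A y)).symm

end Split

end Summit.QuantumFields.YangMills.Theorems.Prop7SpectralSplit

end
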